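import Summits.ResolutionOfSingularities.ResolutionOfSingularities.Theorems.EquisingularLiftEquisingularLiftNatCarrierStrictTransformChart
import Summits.ResolutionOfSingularities.ResolutionOfSingularities.Theorems.EquisingularLiftEquisingularLiftNatEquimultipleStrictTransformFlat
import Summits.ResolutionOfSingularities.ResolutionOfSingularities.Theorems.EquisingularLiftEquisingularLiftNatCoherentJunctionRegular
import Literature.AlgebraicGeometry.Resolution.NodalBlowupChartAlgebra
import HarnessLib

/-!
# [OURS · L1 W4.5(b) · EL♮(3)] T-STFLAT, ring level (K7b of the HSUB′(ReachTC⁺)₃ brick table): the uniformizer is a nonzerodivisor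
# modulo the in-carrier centre `(e₀) + (Φ(e′))` on the chart `A[I/x_j]`, `j = j′+1`, of the blow-up of the section — and the
# regular-system-of-parameters package feeding it (crux `EquisingularLiftNatThree` stmt-ResolutionOfSingularities-20148, parent
# `EquisingularLiftNat` stmt-20038; rung v7 (TC⁺), registered stub `stub_elnat_tcPlusPointResolution`, driver p526242, bricks `inv_step_*`)

NOT a statement of any manuscript. Helper file of the chain res-L1-w45b (cell `res-hironaka`, LADDER-RESOLUTION rung L, slot W4.5(b));
OURS; AI-written, weaker than expert review; `--supports stmt-ResolutionOfSingularities-20148 --as helper` by res-L1-w45b-stub-2 (object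
K7b = T-STFLAT, res-L1-w45b-stub-1's BRICK DEAL 2026-08-27T11:31:42Z). No `sorry`; standard axioms. It closes nothing by itself.

* `notMem_span_image_of_isQuasiRegular` — a member of a quasi-regular sequence with proper ideal is not a combination of the others;
* for `A = 𝒪_{X,p}` with `(x) + (ϖ) = 𝔪`, `dim A = r + 2` (`x : Fin (r+1) → A` the frame of the section, `x₀` the carrier's equation;
  `dim` from T-DIM): `(ϖ, x)` is a regular system of parameters (`isRsopPart_cons_of_sup_span_singleton_eq`), whence (`…_of_sup_span_singleton_eq`)
  `x` quasi-regular with `A/(x)` a domain, `ϖ ∉ (x)`, `ϖ ∉ (x₀)`, `x_l ∉ (x₀, ϖ)` (`l ≠ 0`), `A/(x₀)` a domain of dimension `r + 1` with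
  `ϖ̄` a nonzerodivisor and the reduced tail `x̄′` quasi-regular, `(A/(x₀))/(ϖ̄)` a domain, and `Φ(x′) ∉ (x₀, ϖ)` for a tail form `Φ`
  with `Φ mod 𝔪 ≠ 0` (the in-carrier hypersurface has no vertical component) — all via the tree's `IsRsopPart` API;
* **`mem_carrierSup_of_uniformizer_mul_mem`** — on `B = A[I/x_j]`, `j = j′+1`: `ϖ·y ∈ (e₀) + (Φ(e′)) ⇒ y ∈ (e₀) + (Φ(e′))`: reduce
  modulo `e₀` to the carrier's own chart `(A/x₀)[Ī′/x̄_j′]` (res-L1-w45b-stub-1 p521033 `ker_blowupAlgebraMap_carrier`) and apply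
  res-L1-w45b-stub-1's T-M1-FLAT `mem_span_of_uniformizer_mul_mem` (p517580) there (the stalk/scheme level is the companion
  file …NatInCarrierStepFlat: `flat_carrierStrictTransform_subschemeι_comp`).

References: H. Matsumura, *Commutative Ring Theory* (1986), Thm. 14.2, §16; R. Hartshorne, *Algebraic Geometry* (1977), III Prop. 9.7.
Tree inputs: p521033, p517580, p512232, `IsRsopPart` (Literature RsopMonomialIdeals / NodalBlowupChartAlgebra), …NatCoherentJunctionRegular.
-/

set_option linter.dupNamespace false -- mandated namespace `Summit.<Summit>.<Problem>` of this single-conjunct summit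

noncomputable section

namespace Summit.ResolutionOfSingularities.ResolutionOfSingularities.Cruxes.EquisingularLiftNat.Sections

open MvPolynomial IsLocalRing Literature.AlgebraicGeometry.Resolution
open Summit.ResolutionOfSingularities.ResolutionOfSingularities.Theorems.EquisingularLift.Junction

universe u

/-! ## Quasi-regular sequences: no member lies in the span of the others -/

section QuasiRegular

variable {R : Type u} [CommRing R]

/-- **A member of a quasi-regular sequence is not a combination of the others** (when the ideal of the sequence is proper): a
relation `w_i = Σ_{j ≠ i} a_j w_j` is a linear form vanishing on `w` with a unit coefficient. [cite: Matsumura1987, §16 p. 124] -/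
theorem notMem_span_image_of_isQuasiRegular {ι : Type*} [Fintype ι] [DecidableEq ι] {w : ι → R} (hw : IsQuasiRegular w)
    (hproper : Ideal.span (Set.range w) ≠ ⊤) (i : ι) : w i ∉ Ideal.span (w '' {j | j ≠ i}) := by
  classical
  intro hmem
  have hrange : w '' {j | j ≠ i} = Set.range (fun j : {j : ι // j ≠ i} => w j) := by
    ext a; constructor
    · rintro ⟨j, hj, rfl⟩; exact ⟨⟨j, hj⟩, rfl⟩
    · rintro ⟨⟨j, hj⟩, rfl⟩; exact ⟨j, hj, rfl⟩
  rw [hrange, Ideal.mem_span_range_iff_exists_fun] at hmem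
  obtain ⟨a, ha⟩ := hmem
  -- the linear form `F = X_i - Σ a_j X_j`
  let F : MvPolynomial ι R := X i - ∑ j : {j : ι // j ≠ i}, C (a j) * X (j : ι)
  have hF : F.IsHomogeneous 1 := by
    exact (isHomogeneous_X R i).sub (IsHomogeneous.sum _ _ _ fun j _ => isHomogeneous_C_mul_X _ _)
  have heval : MvPolynomial.eval w F = 0 := by
    simp only [F, map_sub, map_sum, map_mul, MvPolynomial.eval_X, MvPolynomial.eval_C, ← ha, sub_self]
  have hcoeff := (isQuasiRegular_def w).mp hw 1 F hF (by rw [heval]; exact Ideal.zero_mem _) (Finsupp.single i 1)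
  have hci : F.coeff (Finsupp.single i 1) = 1 := by
    have h0 : ∀ j : {j : ι // j ≠ i}, ((C (a j) * X (j : ι) : MvPolynomial ι R)).coeff (Finsupp.single i 1) = 0 := by
      intro j
      rw [MvPolynomial.coeff_C_mul, MvPolynomial.coeff_single_X, if_neg (fun h => j.2 h.2), mul_zero]
    have h1 : ((X i : MvPolynomial ι R)).coeff (Finsupp.single i 1) = 1 := by
      rw [MvPolynomial.coeff_single_X, if_pos ⟨rfl, rfl⟩]
    simp only [F, MvPolynomial.coeff_sub, MvPolynomial.coeff_sum, h0, h1, Finset.sum_const_zero, sub_zero]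
  rw [hci] at hcoeff
  exact hproper ((Ideal.eq_top_iff_one _).mpr hcoeff)

end QuasiRegular

/-! ## The regular-system-of-parameters package at the special point of the section -/

section Rsop

variable {A : Type u} [CommRing A] [IsLocalRing A] [IsNoetherianRing A] {r : ℕ} (x : Fin (r + 1) → A) (ϖ : A)

/-- `(x) + (ϖ) = 𝔪` and `dim A = r + 2` ⇒ `x` is part of a regular system of parameters (…NatCoherentJunctionRegular).
[cite: Matsumura1987, Thm. 14.2] -/
theorem isRsopPart_of_sup_span_singleton_eq (h𝔪 : Ideal.span (Set.range x) ⊔ Ideal.span {ϖ} = maximalIdeal A)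
    (hdim : ringKrullDim A = (r + 2 : ℕ)) : IsRsopPart x :=
  isRsopPart_of_span_range_union_singleton x ϖ hdim (by rw [Ideal.span_union, h𝔪])

/-- The FULL system `(ϖ, x₀, …, x_r)` is a regular system of parameters. [cite: Matsumura1987, Thm. 14.2] -/
theorem isRsopPart_cons_of_sup_span_singleton_eq (h𝔪 : Ideal.span (Set.range x) ⊔ Ideal.span {ϖ} = maximalIdeal A)
    (hdim : ringKrullDim A = (r + 2 : ℕ)) : IsRsopPart (Fin.cons ϖ x : Fin (r + 2) → A) := by
  have hdim' : ringKrullDim A = ((r + 2 + 0 : ℕ) : WithBot ℕ∞) := by rw [Nat.add_zero]; exact hdim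
  refine ⟨(isRsopPart_of_sup_span_singleton_eq x ϖ h𝔪 hdim).isRegularLocalRing, 0, Fin.elim0, hdim', ?_⟩
  have hr : Set.range (Fin.cons ϖ x : Fin (r + 2) → A) ∪ Set.range (Fin.elim0 : Fin 0 → A) = Set.range x ∪ {ϖ} := by
    rw [Fin.range_cons, Set.range_eq_empty (Fin.elim0 : Fin 0 → A), Set.union_empty, ← Set.singleton_union, Set.union_comm]
  rw [hr, Ideal.span_union, h𝔪]

/-- `ϖ ∉ (x₀)` and `x_l ∉ (x₀, ϖ)` for `l ≠ 0`, and `ϖ ∉ (x)`: members of the regular system of parameters `(ϖ, x)` are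
not combinations of the others. [cite: Matsumura1987, Thm. 14.2] -/
theorem notMem_of_sup_span_singleton_eq (h𝔪 : Ideal.span (Set.range x) ⊔ Ideal.span {ϖ} = maximalIdeal A)
    (hdim : ringKrullDim A = (r + 2 : ℕ)) :
    ϖ ∉ Ideal.span (Set.range x) ∧ ϖ ∉ Ideal.span {x 0} ∧
      ∀ l : Fin (r + 1), l ≠ 0 → x l ∉ Ideal.span {x 0} ⊔ Ideal.span {ϖ} := by
  classical
  have hw := isRsopPart_cons_of_sup_span_singleton_eq x ϖ h𝔪 hdim
  have hq := hw.isQuasiRegular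
  have hproper := hw.span_range_ne_top
  have h0 := notMem_span_image_of_isQuasiRegular hq hproper 0
  rw [Fin.cons_zero] at h0
  have hx_sub : Ideal.span (Set.range x) ≤ Ideal.span ((Fin.cons ϖ x : Fin (r + 2) → A) '' {j | j ≠ 0}) := by
    refine Ideal.span_mono ?_
    rintro _ ⟨l, rfl⟩
    exact ⟨l.succ, Fin.succ_ne_zero l, by simp⟩
  refine ⟨fun h => h0 (hx_sub h), fun h => h0 (hx_sub ?_), fun l hl h => ?_⟩
  · exact Ideal.span_mono (Set.singleton_subset_iff.mpr (Set.mem_range_self 0)) h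
  · have hl' := notMem_span_image_of_isQuasiRegular hq hproper l.succ
    rw [Fin.cons_succ] at hl'
    refine hl' ((?_ : Ideal.span {x 0} ⊔ Ideal.span {ϖ} ≤ _) h)
    rw [← Ideal.span_union]
    refine Ideal.span_mono ?_
    rintro a (rfl | rfl)
    · exact ⟨(0 : Fin (r + 1)).succ, fun h => hl (Fin.succ_injective _ h).symm, by simp⟩
    · exact ⟨0, (Fin.succ_ne_zero l).symm, by simp⟩

/-- `A/(x)` is a domain. [cite: Matsumura1987, Thm. 14.3] -/
theorem isDomain_quotient_of_sup_span_singleton_eq (h𝔪 : Ideal.span (Set.range x) ⊔ Ideal.span {ϖ} = maximalIdeal A)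
    (hdim : ringKrullDim A = (r + 2 : ℕ)) : IsDomain (A ⧸ Ideal.span (Set.range x)) := by
  haveI := (isRsopPart_of_sup_span_singleton_eq x ϖ h𝔪 hdim).isRegularLocalRing_quotient
  exact isDomain_of_isRegularLocalRing _

/-- `![0, 1] : Fin 2 → Fin (r + 2)` is injective. [folklore] -/
theorem injective_vec_zero_one : Function.Injective (![0, 1] : Fin 2 → Fin (r + 2)) := by
  intro a b h
  fin_cases a <;> fin_cases b
  · rfl
  · exact absurd h (by simp)
  · exact absurd h (by simp)
  · rfl

omit [IsLocalRing A] [IsNoetherianRing A] in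
/-- The ideal `(ϖ, x₀)` as the span of a sub-family of the regular system of parameters. [folklore] -/
theorem span_range_cons_comp_eq :
    Ideal.span (Set.range ((Fin.cons ϖ x : Fin (r + 2) → A) ∘ (![0, 1] : Fin 2 → Fin (r + 2)))) =
      Ideal.span {x 0} ⊔ Ideal.span {ϖ} := by
  rw [← Ideal.span_union, Set.singleton_union]
  congr 1
  ext a
  simp only [Set.mem_range, Function.comp_apply, Set.mem_insert_iff, Set.mem_singleton_iff]
  constructor
  · rintro ⟨i, rfl⟩
    fin_cases i
    · exact Or.inr (by simp)
    · exact Or.inl (by simp)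
  · rintro (rfl | rfl)
    · exact ⟨1, by simp⟩
    · exact ⟨0, by simp⟩

/-- `(A/(x₀))/(ϖ̄) ≅ A/(x₀, ϖ)` is a domain (a regular local ring). [cite: Matsumura1987, Thm. 14.2] -/
theorem isDomain_quotQuot_of_sup_span_singleton_eq (h𝔪 : Ideal.span (Set.range x) ⊔ Ideal.span {ϖ} = maximalIdeal A)
    (hdim : ringKrullDim A = (r + 2 : ℕ)) :
    IsDomain ((A ⧸ Ideal.span {x 0}) ⧸ Ideal.span {Ideal.Quotient.mk (Ideal.span {x 0}) ϖ}) := by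
  have hw := isRsopPart_cons_of_sup_span_singleton_eq x ϖ h𝔪 hdim
  have h2 := hw.comp (![0, 1] : Fin 2 → Fin (r + 2)) injective_vec_zero_one
  haveI := h2.isRegularLocalRing_quotient
  haveI : IsDomain (A ⧸ Ideal.span (Set.range ((Fin.cons ϖ x : Fin (r + 2) → A) ∘ (![0, 1] : Fin 2 → Fin (r + 2))))) :=
    isDomain_of_isRegularLocalRing _
  have hmap : (Ideal.span {ϖ}).map (Ideal.Quotient.mk (Ideal.span {x 0})) =
      Ideal.span {Ideal.Quotient.mk (Ideal.span {x 0}) ϖ} := by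
    rw [Ideal.map_span, Set.image_singleton]
  let e : ((A ⧸ Ideal.span {x 0}) ⧸ Ideal.span {Ideal.Quotient.mk (Ideal.span {x 0}) ϖ}) ≃+*
      (A ⧸ Ideal.span (Set.range ((Fin.cons ϖ x : Fin (r + 2) → A) ∘ (![0, 1] : Fin 2 → Fin (r + 2))))) :=
    ((Ideal.quotEquivOfEq hmap.symm).trans (DoubleQuot.quotQuotEquivQuotSup _ _)).trans
      (Ideal.quotEquivOfEq (span_range_cons_comp_eq x ϖ).symm)
  exact MulEquiv.isDomain _ e.toMulEquiv

/-- `A/(x₀)` is a domain (a regular local ring) and `dim A/(x₀) = r + 1`. [cite: Matsumura1987, Thm. 14.2] -/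
theorem isDomain_quot_carrier_of_sup_span_singleton_eq (h𝔪 : Ideal.span (Set.range x) ⊔ Ideal.span {ϖ} = maximalIdeal A)
    (hdim : ringKrullDim A = (r + 2 : ℕ)) :
    IsDomain (A ⧸ Ideal.span {x 0}) ∧ ringKrullDim (A ⧸ Ideal.span {x 0}) = (r + 1 : ℕ) := by
  have h1 := (isRsopPart_of_sup_span_singleton_eq x ϖ h𝔪 hdim).comp (fun _ : Fin 1 => (0 : Fin (r + 1)))
    (Function.injective_of_subsingleton _)
  have hrange : Set.range (x ∘ fun _ : Fin 1 => (0 : Fin (r + 1))) = {x 0} := by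
    ext a; simp [eq_comm]
  haveI := h1.isRegularLocalRing_quotient
  haveI : IsDomain (A ⧸ Ideal.span (Set.range (x ∘ fun _ : Fin 1 => (0 : Fin (r + 1))))) := isDomain_of_isRegularLocalRing _
  let e : (A ⧸ Ideal.span (Set.range (x ∘ fun _ : Fin 1 => (0 : Fin (r + 1))))) ≃+* (A ⧸ Ideal.span {x 0}) :=
    Ideal.quotEquivOfEq (by rw [hrange])
  refine ⟨MulEquiv.isDomain _ e.symm.toMulEquiv, ?_⟩
  have hadd := h1.ringKrullDim_quotient_add
  rw [hdim, ringKrullDim_eq_of_ringEquiv e] at hadd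
  obtain ⟨m, hm⟩ := exists_nat_cast_eq_ringKrullDim (R := A ⧸ Ideal.span (Set.range (x ∘ fun _ : Fin 1 => (0 : Fin (r + 1)))))
  rw [ringKrullDim_eq_of_ringEquiv e] at hm
  rw [hm] at hadd ⊢
  have h' : (m + 1 : ℕ) = ((r + 2 : ℕ) : WithBot ℕ∞) := by exact_mod_cast hadd
  have h'' : m + 1 = r + 2 := by exact_mod_cast h'
  have hm1 : m = r + 1 := by omega
  rw [hm1]

/-- `ϖ̄` is a nonzerodivisor of the carrier ring `A/(x₀)`. [folklore] -/
theorem mk_uniformizer_mem_nonZeroDivisors_of_sup_span_singleton_eq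
    (h𝔪 : Ideal.span (Set.range x) ⊔ Ideal.span {ϖ} = maximalIdeal A) (hdim : ringKrullDim A = (r + 2 : ℕ)) :
    Ideal.Quotient.mk (Ideal.span {x 0}) ϖ ∈ nonZeroDivisors (A ⧸ Ideal.span {x 0}) := by
  haveI := (isDomain_quot_carrier_of_sup_span_singleton_eq x ϖ h𝔪 hdim).1
  refine mem_nonZeroDivisors_of_ne_zero fun h => ?_
  exact (notMem_of_sup_span_singleton_eq x ϖ h𝔪 hdim).2.1 (Ideal.Quotient.eq_zero_iff_mem.mp h)

omit [IsNoetherianRing A] in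
/-- The maximal ideal of `A/(x₀)` is `(x̄′) + (ϖ̄)`. [folklore] -/
theorem span_range_tail_sup_eq_maximalIdeal (h𝔪 : Ideal.span (Set.range x) ⊔ Ideal.span {ϖ} = maximalIdeal A)
    [Nontrivial (A ⧸ Ideal.span {x 0})] :
    haveI := IsLocalRing.of_surjective' (Ideal.Quotient.mk (Ideal.span {x 0})) Ideal.Quotient.mk_surjective
    Ideal.span (Set.range fun l : Fin r => Ideal.Quotient.mk (Ideal.span {x 0}) (x l.succ)) ⊔
        Ideal.span {Ideal.Quotient.mk (Ideal.span {x 0}) ϖ} = maximalIdeal (A ⧸ Ideal.span {x 0}) := by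
  rw [maximalIdeal_quotient_eq_map, ← h𝔪, Ideal.map_sup, Ideal.map_span, Ideal.map_span, Set.image_singleton,
    ← Set.range_comp, Fin.range_fin_succ]
  have h0 : (Ideal.Quotient.mk (Ideal.span {x 0}) ∘ x) 0 = 0 :=
    Ideal.Quotient.eq_zero_iff_mem.mpr (Ideal.mem_span_singleton_self _)
  rw [h0, Ideal.span_insert_zero]
  rfl

/-- The reduced tail `x̄′ = (x̄₁, …, x̄_r)` is a regular system of parameters' part of `A/(x₀)`, hence quasi-regular.
[cite: Matsumura1987, Thm. 14.2] -/
theorem isQuasiRegular_tail_of_sup_span_singleton_eq (h𝔪 : Ideal.span (Set.range x) ⊔ Ideal.span {ϖ} = maximalIdeal A)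
    (hdim : ringKrullDim A = (r + 2 : ℕ)) :
    IsQuasiRegular fun l : Fin r => Ideal.Quotient.mk (Ideal.span {x 0}) (x l.succ) := by
  obtain ⟨hdom, hdim₀⟩ := isDomain_quot_carrier_of_sup_span_singleton_eq x ϖ h𝔪 hdim
  haveI := hdom
  haveI := IsLocalRing.of_surjective' (Ideal.Quotient.mk (Ideal.span {x 0})) Ideal.Quotient.mk_surjective
  refine (isRsopPart_of_span_range_union_singleton _ (Ideal.Quotient.mk (Ideal.span {x 0}) ϖ) hdim₀ ?_).isQuasiRegular
  rw [Ideal.span_union]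
  exact span_range_tail_sup_eq_maximalIdeal x ϖ h𝔪

/-- **A tail form with a unit coefficient does not vanish modulo `(x₀, ϖ)`**: `Φ mod 𝔪 ≠ 0 ⇒ Φ(x′) ∉ (x₀) + (ϖ)` — the images of
`x′` in the regular local ring `A/(x₀, ϖ)` form a regular system of parameters, in particular a quasi-regular sequence.
[cite: Matsumura1987, Thm. 14.2, §16] -/
theorem eval_tail_notMem_of_sup_span_singleton_eq (h𝔪 : Ideal.span (Set.range x) ⊔ Ideal.span {ϖ} = maximalIdeal A)
    (hdim : ringKrullDim A = (r + 2 : ℕ)) {m : ℕ} {Φ : MvPolynomial (Fin r) A} (hΦd : Φ.IsHomogeneous m)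
    (hΦ𝔪 : MvPolynomial.map (IsLocalRing.residue A) Φ ≠ 0) :
    MvPolynomial.eval (fun l => x l.succ) Φ ∉ Ideal.span {x 0} ⊔ Ideal.span {ϖ} := by
  classical
  intro hmem
  have hw := isRsopPart_cons_of_sup_span_singleton_eq x ϖ h𝔪 hdim
  have h2 := hw.comp (![0, 1] : Fin 2 → Fin (r + 2)) injective_vec_zero_one
  set 𝔟 : Ideal A := Ideal.span (Set.range ((Fin.cons ϖ x : Fin (r + 2) → A) ∘ (![0, 1] : Fin 2 → Fin (r + 2)))) with h𝔟
  have h𝔟eq : 𝔟 = Ideal.span {x 0} ⊔ Ideal.span {ϖ} := span_range_cons_comp_eq x ϖ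
  haveI hreg := h2.isRegularLocalRing_quotient
  -- the images of the tail form a regular system of parameters of `A/𝔟`
  let xb : Fin r → A ⧸ 𝔟 := fun l => Ideal.Quotient.mk 𝔟 (x l.succ)
  have hdimb : ringKrullDim (A ⧸ 𝔟) = ((r + 0 : ℕ) : WithBot ℕ∞) := by
    have hadd := h2.ringKrullDim_quotient_add
    rw [hdim] at hadd
    obtain ⟨n', hn'⟩ := exists_nat_cast_eq_ringKrullDim (R := A ⧸ 𝔟)
    rw [hn'] at hadd ⊢
    have h' : (n' + 2 : ℕ) = ((r + 2 : ℕ) : WithBot ℕ∞) := by exact_mod_cast hadd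
    have h'' : n' + 2 = r + 2 := by exact_mod_cast h'
    have hn : n' = r + 0 := by omega
    rw [hn]
  have h𝔪b : Ideal.span (Set.range xb ∪ Set.range (Fin.elim0 : Fin 0 → A ⧸ 𝔟)) = maximalIdeal (A ⧸ 𝔟) := by
    rw [Set.range_eq_empty (Fin.elim0 : Fin 0 → A ⧸ 𝔟), Set.union_empty, maximalIdeal_quotient_eq_map, ← h𝔪, Ideal.map_sup,
      Ideal.map_span, Ideal.map_span, Set.image_singleton, ← Set.range_comp, Fin.range_fin_succ]
    have h0 : (Ideal.Quotient.mk 𝔟 ∘ x) 0 = 0 :=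
      Ideal.Quotient.eq_zero_iff_mem.mpr (h𝔟eq ▸ Ideal.mem_sup_left (Ideal.mem_span_singleton_self _))
    have hϖ0 : Ideal.Quotient.mk 𝔟 ϖ = 0 :=
      Ideal.Quotient.eq_zero_iff_mem.mpr (h𝔟eq ▸ Ideal.mem_sup_right (Ideal.mem_span_singleton_self _))
    rw [h0, Ideal.span_insert_zero, hϖ0, Ideal.span_singleton_zero, sup_bot_eq]
    rfl
  have hxb : IsRsopPart xb := ⟨hreg, 0, Fin.elim0, hdimb, h𝔪b⟩
  have hq := hxb.isQuasiRegular
  -- `Φ̄(x̄′) = 0` with `Φ̄ = Φ mod 𝔟` homogeneous of degree `m`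
  have heval : MvPolynomial.eval xb (MvPolynomial.map (Ideal.Quotient.mk 𝔟) Φ) = 0 := by
    have h := MvPolynomial.map_eval (Ideal.Quotient.mk 𝔟) (fun l => x l.succ) Φ
    rw [Ideal.Quotient.eq_zero_iff_mem.mpr (h𝔟eq ▸ hmem)] at h
    exact h.symm
  have hcoeff := (isQuasiRegular_def xb).mp hq m _ (hΦd.map _) (by rw [heval]; exact Ideal.zero_mem _)
  -- every coefficient of `Φ` lies in `𝔪`
  apply hΦ𝔪
  apply map_eq_zero_of_coeff_mem_ker
  intro mo
  rw [IsLocalRing.ker_residue]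
  have hc := hcoeff mo
  rw [MvPolynomial.coeff_map] at hc
  have hle : Ideal.span (Set.range xb) ≤ maximalIdeal (A ⧸ 𝔟) := hxb.span_range_le_maximalIdeal
  have hnu : ¬ IsUnit (Ideal.Quotient.mk 𝔟 (Φ.coeff mo)) := hle hc
  exact fun hu => hnu (hu.map _)

end Rsop

/-! ## The core: `ϖ` is a nonzerodivisor modulo the carrier sup `(e₀) + (Φ(e′))` on the chart `j = j′ + 1` -/

section Core

variable {A : Type u} [CommRing A] {r : ℕ} (x : Fin (r + 1) → A) (j' : Fin r) (ϖ : A)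

/-- Membership modulo `(x₀)`: `ā ∈ (ϖ̄)` in `A/(x₀)` iff `a ∈ (x₀) + (ϖ)`. [folklore] -/
theorem mk_mem_span_mk_iff (a : A) :
    Ideal.Quotient.mk (Ideal.span {x 0}) a ∈ Ideal.span {Ideal.Quotient.mk (Ideal.span {x 0}) ϖ} ↔
      a ∈ Ideal.span {x 0} ⊔ Ideal.span {ϖ} := by
  rw [show ({Ideal.Quotient.mk (Ideal.span {x 0}) ϖ} : Set (A ⧸ Ideal.span {x 0})) =
      Ideal.Quotient.mk (Ideal.span {x 0}) '' {ϖ} from (Set.image_singleton).symm, ← Ideal.map_span, ← Ideal.mem_comap,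
    Ideal.comap_map_of_surjective _ Ideal.Quotient.mk_surjective, ← RingHom.ker_eq_comap_bot, Ideal.mk_ker, sup_comm]

set_option maxHeartbeats 800000 in -- chart algebra `blowupAlgebra` = subalgebra of a localisation: slow unification (cf. p522194)
/-- **CORE of T-STFLAT.** On the chart `B = A[I/x_j]`, `j = j′+1`, of the blow-up of the section `I = (x₀, x′)`: if `x` is
quasi-regular with `A/I` a domain, the reduced tail `x̄′` is quasi-regular in the carrier ring `A/(x₀)` where `ϖ̄` is a
nonzerodivisor with `(A/(x₀))/(ϖ̄)` a domain, `ϖ ∉ I`, `x_j ∉ (x₀, ϖ)`, and the tail form `Φ` (degree `d`) has `Φ(x′) ∉ (x₀, ϖ)`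
(no vertical component of the in-carrier hypersurface), then **`ϖ·y ∈ (e₀) + (Φ(e′)) ⇒ y ∈ (e₀) + (Φ(e′))`** — the uniformizer is
a nonzerodivisor modulo the in-carrier centre. Reduction modulo `e₀ = x₀/x_j` lands in the carrier's own chart
`(A/x₀)[Ī′/x̄_j′]` (`ker = (e₀)`, p521033), where this is T-M1-FLAT (p517580). [cite: Hartshorne1977, III Prop. 9.7 p. 257]
[OURS · L1 W4.5b] K7b toward `stub_elnat_tcPlusPointResolution`; NOT a statement of the manuscript. -/
theorem mem_carrierSup_of_uniformizer_mul_mem (hx : IsQuasiRegular x) [IsDomain (A ⧸ Ideal.span (Set.range x))]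
    (hxb : IsQuasiRegular fun l : Fin r => Ideal.Quotient.mk (Ideal.span {x 0}) (x l.succ))
    (hϖ0 : Ideal.Quotient.mk (Ideal.span {x 0}) ϖ ∈ nonZeroDivisors (A ⧸ Ideal.span {x 0}))
    (hϖx : ϖ ∉ Ideal.span (Set.range x))
    [IsDomain ((A ⧸ Ideal.span {x 0}) ⧸ Ideal.span ({Ideal.Quotient.mk (Ideal.span {x 0}) ϖ} : Set (A ⧸ Ideal.span {x 0})))]
    (hxj : x j'.succ ∉ Ideal.span {x 0} ⊔ Ideal.span {ϖ})
    {d : ℕ} {Φ : MvPolynomial (Fin r) A} (hΦd : Φ.IsHomogeneous d)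
    (hΦϖ : MvPolynomial.eval (fun l => x l.succ) Φ ∉ Ideal.span {x 0} ⊔ Ideal.span {ϖ})
    (y : blowupAlgebra (Ideal.span (Set.range x)) (x j'.succ))
    (hy : algebraMap A (blowupAlgebra (Ideal.span (Set.range x)) (x j'.succ)) ϖ * y ∈
      Ideal.span {blowupAlgebra.frac x j'.succ 0} ⊔
        Ideal.span {MvPolynomial.aeval (fun l => blowupAlgebra.frac x j'.succ l.succ) Φ}) :
    y ∈ Ideal.span {blowupAlgebra.frac x j'.succ 0} ⊔
      Ideal.span {MvPolynomial.aeval (fun l => blowupAlgebra.frac x j'.succ l.succ) Φ} := by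
  classical
  -- adapted from `mem_carrierSup_of_algebraMap_mul_mem` (…NatCarrierStrictTransformChart, res-L1-w45b-stub-1)
  set θ₀ := blowupAlgebraMap (Ideal.Quotient.mk (Ideal.span {x 0})) (Ideal.span (Set.range x))
    (Ideal.span (Set.range fun l : Fin r => Ideal.Quotient.mk (Ideal.span {x 0}) (x l.succ))) (x j'.succ)
    (map_span_range_le_span_range_tail x) with hθ₀
  set T := Ideal.span {blowupAlgebra.frac x j'.succ 0} ⊔
    Ideal.span {MvPolynomial.aeval (fun l => blowupAlgebra.frac x j'.succ l.succ) Φ} with hT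
  haveI := isDomain_quotQuot_tail x
  -- the image of `T` under `θ₀` is the principal ideal of the reduced cone transform `g = Φ̄(ē′)`
  have hTmap : T.map θ₀ = Ideal.span {MvPolynomial.aeval
      (blowupAlgebra.frac (fun l : Fin r => Ideal.Quotient.mk (Ideal.span {x 0}) (x l.succ)) j')
      (MvPolynomial.map (Ideal.Quotient.mk (Ideal.span {x 0})) Φ)} := by
    rw [hT, Ideal.map_sup, Ideal.map_span, Ideal.map_span, Set.image_singleton, Set.image_singleton, hθ₀,
      blowupAlgebraMap_carrier_frac_zero, blowupAlgebraMap_carrier_aeval_tail, Ideal.span_singleton_zero, bot_sup_eq]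
  -- apply `θ₀` to the membership
  have hθy : algebraMap (A ⧸ Ideal.span {x 0}) _ (Ideal.Quotient.mk (Ideal.span {x 0}) ϖ) * θ₀ y ∈ T.map θ₀ := by
    rw [← blowupAlgebraMap_carrier_algebraMap x j' ϖ, ← hθ₀, ← map_mul]
    exact Ideal.mem_map_of_mem _ hy
  rw [hTmap] at hθy
  -- side conditions of T-M1-FLAT on the carrier chart
  have hspan : Ideal.span (Set.range fun l : Fin r => Ideal.Quotient.mk (Ideal.span {x 0}) (x l.succ)) =
      (Ideal.span (Set.range x)).map (Ideal.Quotient.mk (Ideal.span {x 0})) :=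
    le_antisymm (span_range_tail_le_map_span_range x) (map_span_range_le_span_range_tail x)
  have hϖb : Ideal.Quotient.mk (Ideal.span {x 0}) ϖ ∉
      Ideal.span (Set.range fun l : Fin r => Ideal.Quotient.mk (Ideal.span {x 0}) (x l.succ)) := by
    rw [hspan, ← Ideal.mem_comap, Ideal.comap_map_of_surjective _ Ideal.Quotient.mk_surjective, ← RingHom.ker_eq_comap_bot,
      Ideal.mk_ker, sup_eq_left.mpr (Ideal.span_mono (Set.singleton_subset_iff.mpr (Set.mem_range_self 0)))]
    exact hϖx
  have hxbj : (fun l : Fin r => Ideal.Quotient.mk (Ideal.span {x 0}) (x l.succ)) j' ∉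
      Ideal.span ({Ideal.Quotient.mk (Ideal.span {x 0}) ϖ} : Set (A ⧸ Ideal.span {x 0})) := by
    rw [mk_mem_span_mk_iff]
    exact hxj
  have hG : Ideal.Quotient.mk (Ideal.span {x 0}) (MvPolynomial.eval (fun l => x l.succ) Φ) ∉
      Ideal.span ({Ideal.Quotient.mk (Ideal.span {x 0}) ϖ} : Set (A ⧸ Ideal.span {x 0})) := by
    rw [mk_mem_span_mk_iff]
    exact hΦϖ
  have hmk : Ideal.Quotient.mk (Ideal.span {x 0}) (MvPolynomial.eval (fun l => x l.succ) Φ) =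
      MvPolynomial.eval (fun l : Fin r => Ideal.Quotient.mk (Ideal.span {x 0}) (x l.succ))
        (MvPolynomial.map (Ideal.Quotient.mk (Ideal.span {x 0})) Φ) := by
    rw [MvPolynomial.map_eval]; rfl
  have hcone0 := algebraMap_eval_eq_pow_mul_coneTransform (fun l : Fin r => Ideal.Quotient.mk (Ideal.span {x 0}) (x l.succ)) j'
    (hΦd.map (Ideal.Quotient.mk (Ideal.span {x 0})))
  rw [← hmk] at hcone0
  have hg := blowupAlgebraMap_strictTransform_ne_zero (fun l : Fin r => Ideal.Quotient.mk (Ideal.span {x 0}) (x l.succ)) j'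
    (Ideal.Quotient.mk (Ideal.span {x 0}) ϖ) hxbj (MvPolynomial.map (Ideal.Quotient.mk (Ideal.span {x 0})) Φ) 0 hG
    (by rw [mul_zero, add_zero]; exact hcone0)
  rw [mul_zero, add_zero] at hg
  have hcone := mem_span_of_uniformizer_mul_mem (fun l : Fin r => Ideal.Quotient.mk (Ideal.span {x 0}) (x l.succ)) j'
    (Ideal.Quotient.mk (Ideal.span {x 0}) ϖ) hϖ0 hxb hϖb hxbj _ hg (θ₀ y) hθy
  -- pull back along the surjection `θ₀` with kernel `(e₀) ≤ T`
  have hmem : y ∈ (T.map θ₀).comap θ₀ := by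
    rw [Ideal.mem_comap, hTmap]
    exact hcone
  rw [Ideal.comap_map_of_surjective _ (blowupAlgebraMap_carrier_surjective x j'), ← RingHom.ker_eq_comap_bot,
    ker_blowupAlgebraMap_carrier x j' hx] at hmem
  have hle : T ⊔ Ideal.span {blowupAlgebra.frac x j'.succ 0} ≤ T := sup_le le_rfl (by rw [hT]; exact le_sup_left)
  exact hle hmem

end Core

end Summit.ResolutionOfSingularities.ResolutionOfSingularities.Cruxes.EquisingularLiftNat.Sections

end
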